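import Literature.IUT.HodgeArakelov.BadPrimeGaussianMonoidsRestrictionIsoKummerProofs
import Literature.IUT.HodgeArakelov.BadPrimeGaussianMonoidsCohomologyModelSectionsProofs
import Literature.IUT.HodgeArakelov.CohomologyLimitComapFunctorProofs

/-!
# [IUTchII] Cor 3.5 (ii): the restriction ISOMORPHISM `Ψ^ι_env ⥲ Ψ_ξ` at the cohomology model (label-wise
# evaluation sections) — input (R) "restriction of constants" DERIVED from the section identity, so that the
# clause rests on the Kummer maps and the THETA EVALUATION only (proof-only sequel to
# `…RestrictionIsoKummerProofs.lean`, `…CohomologyModelSectionsProofs.lean`, `CohomologyLimitComapFunctorProofs.lean`)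

S. Mochizuki, *Inter-universal Teichmüller theory II*, kurims Dec-2020 manuscript, Cor 3.5 (i)/(ii) pp. 94–95, Cor 2.8
(i) p. 82, Prop 3.1 (ii) p. 88 [cite: Mochizuki2012, Cor 3.5 (ii) p.95]. Claim key DISPUTED (D-0012). PROOF-ONLY
companion (abc-iut cell, layer L6, seat abc-iut-w4-d004 gen 2; node **IUTchII:Cor3.5(ii)**, restriction-ISO clause,
sub-DAG row Cor-35.ii.r12). NO definition, NO `Prop` fact.

SETTING (the label-wise cohomology model of `…CohomologyModelSectionsProofs`, with the coefficient action of `Π`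
FACTORING through `proj : Π ↠ G_v` — the cyclotome `Π_μ ≅ Ẑ(1)` is a `G_v`-module — i.e. `φ = φ₀ ∘ proj`): ambient
module `lim_K H¹(Π_Ÿ|_K, A)` (`h1Lim (φ₀ ∘ proj) A N ⊥`), label-wise evaluation SECTIONS `ι_t = j ∘ s_t : G_v → Π` of
`proj` landing in `Π_Ÿ` (Cor 2.4 (ii)(c)), restrictions `R_t = h1LimCongr ∘ ι_t^* ∘ ψ` into the labeled copy
`lim_{K₀} H¹(G_v ⊓ K₀, A)`, and the constants: the Kummer map `κ` of `Ψ_cns` (Prop 3.1 (ii)) is the PULL-BACK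
`proj^* ∘ κ₀` of the `G_v`-level Kummer map `κ₀ : M_TM → lim_{K₀} H¹(G_v ⊓ K₀, A)` (`hκ₀ψ` — the printed definition
"`Ψ_cns(M^Θ_*) := M_TM(M^Θ_*) ⊆ lim_J H¹(Π_Ÿ(M^Θ_*)|_J, Π_μ)`", constants being classes of `G_v`).
* `comp_section_eq` — `(φ₀ ∘ proj) ∘ ι_t = φ₀` (the common coefficient action, from `proj ∘ ι_t = id`);
* `restriction_kummer_eq` — **input (R) DERIVED**: `R_t (κ m) = κ₀ m` for every label (abc-iut-w4-d004
  `h1LimCongr_comap_section`: `ι_t^* ∘ proj^* = id`);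
* `exists_unique_restrictionIso'_ofCohomologyModel` — **the restriction isomorphism of record `Ψ^ι_env ⥲ Ψ_ξ`,
  unique, at the cohomology model**, from: `κ`, `κ₀` injective (Kummer theory; G-w4d019-1 / [AbsTopIII] Prop 3.2),
  `Ψ_cns = κ(M_TM)`, `κ = proj^* κ₀` read through `ψ`, `horb` (derived at the produced record, p420268), and the
  THETA EVALUATION `R_t θ = κ₀ q_t` with unique factorisation `M_TM^× × q_{t₀}^ℕ` at one label (Cor 2.8 (i) /
  Rmk 2.5.1 (i): the theta value `q_v^{j²}`, a non-unit for `j ≠ 0`) — the ONE load-bearing input of the clause.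
Together with `…CohomologyModelSectionsProofs` (Galois clause), BOTH clauses of IUTchII:Cor3.5(ii) are thus reduced,
in the kernel, to identification data + Kummer injectivity + the theta-evaluation identity. Nothing here asserts a
disputed claim or takes a side on [IUTchIII] Cor 3.12; typed ≠ proved ≠ endorsed.
-/

namespace Literature.IUT.HodgeArakelov

namespace BadPrimeGaussianMonoids

open Literature.AnabelianGeometry.EtaleTheta CohomologySystemOfContH1 TemperedThetaMonoids

universe u v

section Assembly

variable {S : ThetaSetting.{u}} (A : AbsTopMonoids S) (Pc : IsoClass S.PiX)
  (E : TemperedThetaMonoids.ThetaEnvData.{u, v} Pc.G) (κ : A.MTM Pc →* E.H) {L : Type*}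
  {P₀ P : TopGroup.{u}} {G' : Type u} [Group G'] [TopologicalSpace G'] [IsTopologicalGroup G']
  (φ₀ : P₀ →* G') (Am : Subgroup G') [Am.Normal] [IsMulCommutative Am] (N : Subgroup P)
  (proj : P →* P₀) (hproj : Continuous proj) (j : Pc.G →* P) (ψ : Additive E.H ≃+ h1Lim (φ₀.comp proj) Am N ⊥)
  (s : L → (P₀ →* Pc.G)) (hι : ∀ t, Continuous (j.comp (s t)))
  (hN : ∀ t, (⊤ : Subgroup P₀).map (j.comp (s t)) ≤ N)
  (κ₀ : A.MTM Pc →* Multiplicative (h1Lim φ₀ Am (⊤ : Subgroup P₀) ⊥))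

omit [TopologicalSpace G'] [IsTopologicalGroup G'] in
/-- The common coefficient action: `(φ₀ ∘ proj) ∘ ι_t = φ₀` for every section `ι_t = j ∘ s_t` of `proj`.
[cite: Mochizuki2012, Cor 3.5 (ii) p.95] -/
theorem comp_section_eq (hsec : ∀ t, proj.comp (j.comp (s t)) = MonoidHom.id P₀) (t : L) :
    (φ₀.comp proj).comp (j.comp (s t)) = φ₀ := by
  rw [MonoidHom.comp_assoc, hsec t, MonoidHom.comp_id]

variable (hsec : ∀ t, proj.comp (j.comp (s t)) = MonoidHom.id P₀)
  (R : L → (E.H →* Multiplicative (h1Lim φ₀ Am (⊤ : Subgroup P₀) ⊥)))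

/-- **Input (R) DERIVED at the model**: the restriction along the section of label `t` of the Kummer class of a
constant is its `G_v`-level Kummer class, `R_t (κ m) = κ₀ m`, for EVERY label — when the restrictions are pinned to
`h1LimCongr ∘ ι_t^* ∘ ψ` and the constants are the pulled-back `G_v`-classes (`κ = proj^* κ₀` through `ψ`), by the
section identity `ι_t^* ∘ proj^* = id` (`h1LimCongr_comap_section`). [cite: Mochizuki2012, Cor 3.5 (i) p.94] -/
theorem restriction_kummer_eq
    (hR : ∀ t y, Multiplicative.toAdd (R t y) =
      h1LimCongr Am ⊤ (comp_section_eq Pc φ₀ proj j s hsec t) ⊥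
        (h1LimComap (φ₀.comp proj) Am (j.comp (s t)) (hι t) (hN t) (ψ (Additive.ofMul y))))
    (hκ₀ψ : ∀ m, ψ (Additive.ofMul (κ m)) =
      h1LimComap φ₀ Am proj hproj le_top (Multiplicative.toAdd (κ₀ m)))
    (t : L) (m : A.MTM Pc) : R t (κ m) = κ₀ m := by
  apply Multiplicative.toAdd.injective
  rw [hR, hκ₀ψ]
  exact h1LimCongr_comap_section φ₀ Am N proj hproj (j.comp (s t)) (hι t) (hN t) (hsec t) le_top _ _

/-- **IUTchII:Cor3.5(ii)** (kurims p.95) **the restriction ISOMORPHISM `Ψ^ι_env ⥲ Ψ_ξ` of record, UNIQUE, at the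
cohomology model with label-wise evaluation sections**: restrictions out of the theta monoid are
`R_t|_{Ψ^ι_env}` co-restricted to the labeled copy `κ₀(M_TM)`; inputs: `κ`, `κ₀` injective and `Ψ_cns = κ(M_TM)`,
`κ = proj^* κ₀` (through `ψ`), the identification data of the label-wise model, `horb`, and the THETA EVALUATION
`R_t θ = κ₀ q_t` with unique factorisation at one label `t₀`. [cite: Mochizuki2012, Cor 3.5 (ii) p.95] -/
theorem exists_unique_restrictionIso'_ofCohomologyModel (hκ : Function.Injective κ)
    (hcns : E.constantMonoid = MonoidHom.mrange κ) {i₀ : E.Iota} {θ : E.H} (hθ : θ ∈ E.thetaEnv i₀)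
    (horb : ∀ θ' ∈ E.thetaEnv i₀, ∃ u ∈ E.units, θ' = u * θ)
    (hR : ∀ t y, Multiplicative.toAdd (R t y) =
      h1LimCongr Am ⊤ (comp_section_eq Pc φ₀ proj j s hsec t) ⊥
        (h1LimComap (φ₀.comp proj) Am (j.comp (s t)) (hι t) (hN t) (ψ (Additive.ofMul y))))
    (hκ₀ψ : ∀ m, ψ (Additive.ofMul (κ m)) =
      h1LimComap φ₀ Am proj hproj le_top (Multiplicative.toAdd (κ₀ m)))
    (hκ₀ : Function.Injective κ₀) (q : L → A.MTM Pc) (hRθ : ∀ t, R t θ = κ₀ (q t)) (t₀ : L)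
    (hq₀ : ∀ (m m' : (A.MTM Pc)ˣ) (n n' : ℕ),
      (m : A.MTM Pc) * q t₀ ^ n = m' * q t₀ ^ n' → n = n' ∧ m = m') :
    ∃! e : E.thetaMonoid i₀ ≃*
        gaussianMonoid (fun t => ((R t).comp (E.thetaMonoid i₀).subtype).codRestrict (MonoidHom.mrange κ₀)
          (restriction_mem_mrange A Pc E κ κ₀ (fun t => (R t).comp (E.thetaMonoid i₀).subtype) q hκ hcns hθ horb
            (fun t m _ => restriction_kummer_eq A Pc E κ φ₀ Am N proj hproj j ψ s hι hN κ₀ hsec R hR hκ₀ψ t m)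
            (fun t => hRθ t) t)
            ⟨θ, thetaEnv_subset_thetaMonoid E i₀ hθ⟩),
      ∀ x, ((e x : gaussianMonoid _) : L → MonoidHom.mrange κ₀) =
        MonoidHom.pi (fun t => ((R t).comp (E.thetaMonoid i₀).subtype).codRestrict (MonoidHom.mrange κ₀)
          (restriction_mem_mrange A Pc E κ κ₀ (fun t => (R t).comp (E.thetaMonoid i₀).subtype) q hκ hcns hθ horb
            (fun t m _ => restriction_kummer_eq A Pc E κ φ₀ Am N proj hproj j ψ s hι hN κ₀ hsec R hR hκ₀ψ t m)
            (fun t => hRθ t) t)) x :=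
  exists_unique_restrictionIso'_ofKummer A Pc E κ κ₀ (fun t => (R t).comp (E.thetaMonoid i₀).subtype) q hκ
    hcns hθ horb
    (fun t m _ => restriction_kummer_eq A Pc E κ φ₀ Am N proj hproj j ψ s hι hN κ₀ hsec R hR hκ₀ψ t m)
    (fun t => hRθ t) hκ₀ t₀ hq₀

end Assembly

end BadPrimeGaussianMonoids

end Literature.IUT.HodgeArakelov
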